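import Literature.MathematicalPhysics.QuantumFieldTheory.Balaban1983to89.B7ConclOneStep
import Literature.MathematicalPhysics.QuantumFieldTheory.Balaban1983to89.B7Prop5General
import Literature.MathematicalPhysics.QuantumFieldTheory.Balaban1983to89.B7Prop6GeneralLevels
import Literature.MathematicalPhysics.QuantumFieldTheory.Balaban1983to89.B7Prop6GeneralAnalytic
import Literature.MathematicalPhysics.QuantumFieldTheory.Balaban1983to89.B7Prop7Ins

/-!
# `Balaban1983to89.B7ConclKExp` — T. Bałaban, *Averaging operations for lattice gauge theories*, Commun. Math. Phys. **98** (1985)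
17–51 [Balaban1985Averaging]: **the abstract `k`-fold carrier `B7.KExp` of `B7.lean` INSTANTIATED on the concrete `ℤᵈ` objects of the
lineage, and the decls of record `B7.Prop4Printed` (Prop. 4 (134)–(135) pp. 38–39), `B7.Prop5Printed` (Prop. 5 (156)–(157) p. 42),
`B7.Prop6Printed` (Prop. 6 (164) p. 43) and `B7.Prop7Printed` (Prop. 7 p. 43) PROVED for this ONE family** (model instance; the shape
`B7.Concl` consumes: ONE `kexp : I₃ → KExp` serving `p4`, `p5`, `p6`, `p7`).

statement-level skeleton of published theorems with citation tags; proofs where landed; nothing here is a claim about the Yang–Mills mass gap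

CITATION HEADER (lean-in-tree rule).  Cell `lit-balaban`, unit `lit-balaban-r04` (owner of block B7, gen 6).  MODEL-INSTANCE file for SKELETON
rows `B7.Prop4`, `B7.Prop5`, `B7.Prop6`, `B7.Prop7` (decls of record `B7.Prop4Printed` … `B7.Prop7Printed` over the abstract carrier
`B7.KExp`; until now NO `B7.KExp` family existed in the tree, the rows' kernels being stated directly on the `ℤᵈ` objects).  Kernels used,
BY NAME: Prop. 4 — `B7Eq123General.prop4_general` ((130)/(131) @gen, k-uniform [p06]) and `B7Prop6GeneralAnalytic.prop4_general_analyticAt`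
(analyticity clause); Prop. 5 — `B7Prop5General.prop5_general_156_printed` / `prop5_general_157_printed` [p06] with
`B7Prop5General.smallness_sufficient`; Prop. 6 — `B7Prop6GeneralLevels.eq164_general_unconditional`; Prop. 7 —
`B7Prop7Levels.prop7_prop4_uniform` / `prop7_analyticAt`.

PRINT (verbatim).  Prop. 4 pp. 38–39: "There exist constants `C₂, c₄` such that for `α₀, α₁ ≦ c₄` the function `Q_k(U₀, ηA, c) =
(1/i) log(Ū₁ᵏ)_c`, `c ⊂ Ω^{(k)}`, is an analytic function of the variables `A_b`, `b ⊂ Bᵏ(c₋) ∪ Bᵏ(c₊)`. Further we have `Q_k(U₀, ηA) =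
Q_k(U₀)A + C_k(U₀, A)`, (134) and `|C_k(U₀, A)| ≦ C₂|A|² < C₂α₁²`. (135) The constants `C₂, c₄` are independent of `k`, `C₂` depends on `d`
and `c₄` depends on `d` and `L`."  Prop. 5 p. 42: "The functional derivative of `Q_k(U₀, ηA)` is a bounded function for `α₀, α₁` sufficiently
small, and we have the bounds `|(δ/δA_b)Q_k(U₀, ηA, c)| ≦ 1 + 2C′₁α₀ + C₃|A| < 1 + 2C′₁α₀ + C₃α₁`, (156) `|(δ/δA_b)C_k(U₀, A, c)| ≦ C₃|A| <
C₃α₁`. (157)"  Prop. 6 p. 43: "If `U₀` satisfies (52), then `\overline{U′U₀}ᵏ` is an analytic function of `A′ = (1/(iη)) log U′` for `A′` with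
values in the complexified algebra, and satisfying `|A′| < α₁`. Moreover, we have a bound `|\overline{U′U₀}ᵏ(Ū₀ᵏ)⁻¹ − 1| < O(1)α₁`. (164) Of
course, we assume that `α₀, α₁` are sufficiently small."  Prop. 7 p. 43: "For `U₀` satisfying (52) and `U′ = e^{iηA′}`, `|A′| < α₁`, `α₀, α₁`
sufficiently small, the function `Q_k(U′U₀, ηA)` is analytic in complex variables `A′, A`, and Proposition 4 holds uniformly in `A′`."

THE FAMILY `concreteKExp 𝔸 G L` (index `i = (k; c; b)`: the order `k`, a bond `c = ⟨z, z + e_κ⟩` of the `k`-th lattice `Ω^{(k)}` — where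
(127)/(134)/(135)/(164) are read — and a bond `b = ⟨y, y + e_μ⟩` of the fine `η`-lattice — the `δ/δA_b` of (156)/(157); all
configuration-independent, family convention D-pv14.2 of `B7.lean`, `η = L^{−k}` fixed by `i`).  `Cfg` = ALL configurations
`ℤᵈ → (Fin d → 𝔸ˣ)` (lineage dictionary: the `η`-lattice read on `ℤᵈ`) — the type must host both the `G`-valued backgrounds `U₀` of (52) and the
complex-perturbed backgrounds `U′U₀ = pert U₀ A′` of Prop. 7; `plaqDevEta U = η⁻²·sup_p‖U(∂p) − 1‖ + grpDefect G U`, where `grpDefect` is `0`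
for a `G`-valued configuration and `1` otherwise: (52) «|U(∂p) − 1| < α₀η²» is a condition on `G`-valued lattice gauge fields (p. 18, p. 23),
and for admissible `α₀ ≤ c ≤ ½` the hypothesis `plaqDevEta U < α₀` is thereby EQUIVALENT to «`U` is `G`-valued and satisfies (52)»
(`regime_of_dev_lt`).  `Fld` = bounded `𝔸`-valued bond fields `A` on the `η`-lattice (the PRINTED variable: `U₁ = e^{iηA}`, internally
`B = η•A` as in `B7Prop5General`'s printed forms), `fldNorm A = |A| = sup_b‖A_b‖`; `IsAnalyticQk U₀ r` = for every finite bond set `S`,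
`(A_b)_{b∈S} ↦ Q_k(U₀, ηA, c)` (the composite (127) `logCovIter L U₀ (η•A) k c`) is analytic on a neighbourhood of every point of the polydisc
`{∀ b, ‖A_b‖ < r}`; `remCk U₀ A = ‖C_k(U₀, A)(c)‖ = ‖Q_k(U₀, ηA)(c) − (Q_k(U₀)A)(c)‖` ((134) in the units `Lᵏη = 1`: `logCovIter − linCovIter`);
`dQk U₀ A = sup_{‖X‖≤1} η^{−d}‖dQ_k(U₀, ηA; X·δ_b)(c)‖` and `dCk` likewise for `C_k` — the functional derivative (137)–(138)
«⟨δF/δA, δA⟩ = Σ_b η^d tr((δF/δA_b)δA_b)» read, as in `B7Prop5General`, as the density of the directional derivative (`lineDeriv ℂ`) in the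
single-bond directions `X·δ_b` (`B7Prop5Flat.bump`); `pert U₀ A′ = e^{ηA′}·U₀` (`B7Prop3Flat.expCfg (η•A′) * U₀`, (158)); `avgRatioDev U₀ A′ =
sup_c‖\overline{U′U₀}ᵏ(c)(Ū₀ᵏ(c))⁻¹ − 1‖` (left side of (164), `B7Prop2Explicit.avgIter`); `IsJointlyAnalytic U₀ r′ r` = for every two finite bond
sets `S′`, `S`, `(A′, A) ↦ Q_k(e^{ηA′}U₀, ηA)(c)` is analytic on a neighbourhood of every point of the polydisc `{‖A′_b‖ < r′} × {‖A_b‖ < r}`.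

WHAT THIS FILE PROVES (kernel, no `sorry`, standard axioms), for `L ≥ 2`, `G` any `AvgClosed` gauge group (`B7Prop2Explicit.AvgClosed`;
`U(N)`, the unitary group of a C⋆-algebra), `𝔸` any complete normed `ℂ`-algebra with `‖1‖ = 1`, with ONE explicit threshold
`c = cK d L` (depends on `d` and `L`) in all four statements:
* `prop4Printed_K : B7.Prop4Printed (concreteKExp 𝔸 G L)` — `C₂ = 16C₁`, `C₁ = 131072(d+1)²` (depends on `d` only; k-uniform);
* `prop5Printed_K : B7.Prop5Printed (concreteKExp 𝔸 G L)` — `C′₁ = 1600(d+1)(d+4)L^{d+1}` (so `2C′₁α₀ = thetaGen d L α₀`),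
  `C₃ = C3Gen d L` (both depend on `d`, `L`, as print says of `C′₁`, `C″₁`);
* `prop6Printed_K : B7.Prop6Printed (concreteKExp 𝔸 G L)` — `O(1) = 200(d+1)`;
* `prop7Printed_K : B7.Prop7Printed (concreteKExp 𝔸 G L)` — `C₂ = 16C₁′`, `C₁′ = 2097152(d+1)²`;
* `p4567_K` — the conjunction.
READINGS (located, inherited from the kernels and `B7.lean`): `≤`/`<` as typed in `B7.lean`; Banach carrier, `U1 ⊇ G`; (134)/(135) in the
units `Lᵏη = 1` (census G-adv8-7 (iii)); the analyticity clauses over every finite set of bond variables (print: the variables `A_b`,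
`b ⊂ Bᵏ(c₋) ∪ Bᵏ(c₊)`); the guard `grpDefect` (above).  NOT CLAIMED: anything beyond the four typed statements.
DECLARATIONS: `KIdx`, `grpDefect`, `supNorm`, `cK`, the family `concreteKExp`, theorems.  Unit `lit-balaban-r04` (gen 6), 2026-08-21.

[cite: Balaban1985Averaging, Proposition 4 (134)–(135) pp.38–39, Proposition 5 (156)–(157) p.42, Proposition 6 (164) p.43, Proposition 7 p.43, (127) p.37, (137)–(138) p.39, (158) p.42, (52) p.26]
-/

noncomputable section

open scoped BigOperators
open NormedSpace

namespace Literature.MathematicalPhysics.QuantumFieldTheory.Balaban1983to89.B7ConclKExp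

open B7Prop1Explicit B7Prop2Explicit B7Prop3Flat B7Prop4GeneralLevels B7Prop5Flat B7Prop5GeneralInduction B7Prop5GeneralLevels
  B7ConclOneStep

-- `Site` alone would resolve to the torus sites of `Setup.lean`; re-export the `ℤ^d` sites of `B7Prop1Explicit`.
export B7Prop1Explicit (Site)

variable {d : ℕ}

/-! ## §1 Index, guard, scaling, thresholds -/

/-- The family index of the `k`-fold carrier: the order `k`, a bond `c = ⟨z, z + e_κ⟩` of `Ω^{(k)}` (level-`k` coordinates `ℤᵈ`; (127),
(134)–(135), (164) are read at `c`) and a bond `b = ⟨y, y + e_μ⟩` of the fine lattice (the `δ/δA_b` of (156)–(157)).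
[cite: Balaban1985Averaging, (127) p.37, (156)–(157) p.42] -/
structure KIdx (d : ℕ) where
  /-- the order `k` of the averaging (`η = L^{−k}`) -/
  k : ℕ
  /-- starting point of the bond `c` of `Ω^{(k)}` -/
  z : Site d
  /-- direction of `c` -/
  κ : Fin d
  /-- starting point of the fine bond `b` -/
  y : Site d
  /-- direction of `b` -/
  μ : Fin d

section Guard

variable {𝔸 : Type*} [Monoid 𝔸]

open Classical in
/-- `0` for a `G`-valued configuration, `1` otherwise: (52) is a condition on `G`-valued lattice gauge fields (p. 18 «`U(N)`», p. 23), and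
the carrier type `Cfg` of `B7.KExp` must also host the complex-perturbed backgrounds `U′U₀` of Prop. 7 — plumbing. [cite: Balaban1985Averaging, (52) p.26, p.23] -/
def grpDefect (G : Subgroup 𝔸ˣ) (U : Site d → Fin d → 𝔸ˣ) : ℝ :=
  if (∀ (x : Site d) (κ : Fin d), U x κ ∈ G) then 0 else 1

/-- `grpDefect = 0` on `G`-valued configurations. [cite: Balaban1985Averaging, (52) p.26] -/
theorem grpDefect_of_mem {G : Subgroup 𝔸ˣ} {U : Site d → Fin d → 𝔸ˣ} (h : ∀ (x : Site d) (κ : Fin d), U x κ ∈ G) :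
    grpDefect G U = 0 := by
  unfold grpDefect; rw [if_pos h]

/-- `grpDefect = 1` off the `G`-valued configurations. [cite: Balaban1985Averaging, (52) p.26] -/
theorem grpDefect_of_not_mem {G : Subgroup 𝔸ˣ} {U : Site d → Fin d → 𝔸ˣ} (h : ¬ ∀ (x : Site d) (κ : Fin d), U x κ ∈ G) :
    grpDefect G U = 1 := by
  unfold grpDefect; rw [if_neg h]

end Guard

section Regime

variable {𝔸 : Type*} [NormedRing 𝔸]

/-- **«`U₀` satisfies (52)» decoded from the carrier's deviation functional**: `η⁻²·sup_p‖U(∂p) − 1‖ + grpDefect G U < α₀ ≤ 1` iff-direction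
used: `U` is `G`-valued and `sup_p‖U(∂p) − 1‖ < α₀η²` (the hypothesis `h52` of the lineage's kernels). [cite: Balaban1985Averaging, (52) p.26] -/
theorem regime_of_dev_lt {G : Subgroup 𝔸ˣ} {U : Site d → Fin d → 𝔸ˣ} {L k : ℕ} (hL : 1 ≤ L) {α₀ : ℝ}
    (h : pdev U * ((L : ℝ) ^ k) ^ 2 + grpDefect G U < α₀) (hα : α₀ ≤ 1) :
    (∀ (x : Site d) (κ : Fin d), U x κ ∈ G) ∧ pdev U < α₀ * (((L : ℝ) ^ k)⁻¹) ^ 2 := by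
  have hL0 : (0 : ℝ) < L := by exact_mod_cast hL
  have hp : 0 ≤ pdev U * ((L : ℝ) ^ k) ^ 2 := mul_nonneg (pdev_nonneg U) (by positivity)
  have hG : ∀ (x : Site d) (κ : Fin d), U x κ ∈ G := by
    by_contra hn
    rw [grpDefect_of_not_mem hn] at h
    linarith
  refine ⟨hG, ?_⟩
  rw [grpDefect_of_mem hG, add_zero] at h
  have hLk : (0 : ℝ) < ((L : ℝ) ^ k) ^ 2 := by positivity
  rw [inv_pow, ← div_eq_mul_inv, lt_div_iff₀ hLk]
  exact h

end Regime

/-- **The threshold `c = c(d, L)`** («`c₄` depends on `d` and `L`», «`α₀, α₁` sufficiently small») below which all four propositions are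
applied: the minimum of the explicit smallness conditions of the lineage's kernels — Prop. 2's `C₀α₀ ≤ ⅓`, `8α₀ ≤ c₂′`; the (123)-route
`e^{4cα₀}(1 + 8C₁|A|) ≤ 2`, `2|A| ≤ c₃/4`; Prop. 5's (145)/(155); Prop. 7's `409600(d+1)²|A′| ≤ 1`, `e^{E}(1 + 8C₁′|A|) ≤ 2`; and `½` (the
guard). [cite: Balaban1985Averaging, Proposition 4 p.39 («c₄ depends on d and L»), (145) p.40, (155) p.41] -/
def cK (d L : ℕ) : ℝ :=
  min (1 / 2) <| min (1 / (3 * C0 d)) <| min (c2' d L / 8) <|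
  min (1 / (16 * (800 * ((d : ℝ) + 1) ^ 2 * ((d : ℝ) + 4)))) <|
  min (1 / (8 * (4480 * ((d : ℝ) + 1) ^ 2 * ((d : ℝ) + 4)))) <|
  min ((L : ℝ) ^ 3 / (16 * (2 * (d : ℝ) + 1) * (3200 * ((d : ℝ) + 1) * ((d : ℝ) + 4) * (L : ℝ) ^ (d + 1)))) <|
  min (c3 d L / 8) <| min (1 / (409600 * ((d : ℝ) + 1) ^ 2)) <| min (1 / (8 * (240000 * ((d : ℝ) + 1) ^ 3))) <|
  min (1 / (32 * (2097152 * ((d : ℝ) + 1) ^ 2))) (1 / ((2 * (d : ℝ) + 1) * C3Gen d L))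

/-- `C3Gen d L > 0` for `L ≥ 1` (the lineage's lemma is private). [cite: Balaban1985Averaging, Proposition 5 p.42] -/
theorem C3Gen_pos' (d : ℕ) {L : ℕ} (hL : 1 ≤ L) : 0 < C3Gen d L := by
  have : (0 : ℝ) < L := by exact_mod_cast hL
  unfold C3Gen C1ppGen; positivity

/-- the threshold is positive (`L ≥ 1`). [cite: Balaban1985Averaging, Proposition 4 p.39] -/
theorem cK_pos (d : ℕ) {L : ℕ} (hL : 1 ≤ L) : 0 < cK d L := by
  have hL0 : (0 : ℝ) < L := by exact_mod_cast hL
  have h1 := C0_pos d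
  have h2 : 0 < c2' d L := by unfold c2'; positivity
  have h3 := c3_pos d hL
  have h4 := C3Gen_pos' d hL
  unfold cK
  refine lt_min (by norm_num) (lt_min (by positivity) (lt_min (by positivity) (lt_min (by positivity) (lt_min (by positivity)
    (lt_min (by positivity) (lt_min (by positivity) (lt_min (by positivity) (lt_min (by positivity) (lt_min (by positivity)
    (by positivity))))))))))

/-- an elementary exponential bound: `e^{x}(1 + y) ≤ 2` for `0 ≤ x, y ≤ ¼` (`e^{1/4} ≤ 4/3`). [cite: Balaban1985Averaging, (131) p.38] -/
theorem exp_mul_le_two {x y : ℝ} (hx0 : 0 ≤ x) (hx : x ≤ 1 / 4) (hy0 : 0 ≤ y) (hy : y ≤ 1 / 4) :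
    Real.exp x * (1 + y) ≤ 2 := by
  have h := Real.exp_bound_div_one_sub_of_interval hx0 (by linarith)
  have h1 : 1 / (1 - x) ≤ 4 / 3 := by
    rw [div_le_div_iff₀ (by linarith) (by norm_num)]; linarith
  calc Real.exp x * (1 + y) ≤ (4 / 3) * (1 + 1 / 4) :=
        mul_le_mul (h.trans h1) (by linarith) (by linarith) (by norm_num)
    _ ≤ 2 := by norm_num

/-- `e^{x} ≤ 2` for `0 ≤ x ≤ ¼`. [cite: Balaban1985Averaging, (131) p.38] -/
theorem exp_le_two {x : ℝ} (hx0 : 0 ≤ x) (hx : x ≤ 1 / 4) : Real.exp x ≤ 2 := by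
  have := exp_mul_le_two hx0 hx le_rfl (by norm_num)
  linarith

/-- `e⁻¹·(M·(e·x)) = M·x` for `e ≠ 0` — the density normalisation `η^{−d}` of (138). [cite: Balaban1985Averaging, (138) p.39] -/
theorem inv_mul_mul_cancel {e M x : ℝ} (he : e ≠ 0) : e⁻¹ * (M * (e * x)) = M * x := by
  field_simp

section Thresholds

variable {d : ℕ} {L : ℕ}

/-- unpacking the minimum: every explicit condition follows from `t ≤ cK d L`. [cite: Balaban1985Averaging, Proposition 4 p.39] -/
theorem cK_le (d L : ℕ) :
    cK d L ≤ 1 / 2 ∧ cK d L ≤ 1 / (3 * C0 d) ∧ cK d L ≤ c2' d L / 8 ∧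
    cK d L ≤ 1 / (16 * (800 * ((d : ℝ) + 1) ^ 2 * ((d : ℝ) + 4))) ∧
    cK d L ≤ 1 / (8 * (4480 * ((d : ℝ) + 1) ^ 2 * ((d : ℝ) + 4))) ∧
    cK d L ≤ (L : ℝ) ^ 3 / (16 * (2 * (d : ℝ) + 1) * (3200 * ((d : ℝ) + 1) * ((d : ℝ) + 4) * (L : ℝ) ^ (d + 1))) ∧
    cK d L ≤ c3 d L / 8 ∧ cK d L ≤ 1 / (409600 * ((d : ℝ) + 1) ^ 2) ∧ cK d L ≤ 1 / (8 * (240000 * ((d : ℝ) + 1) ^ 3)) ∧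
    cK d L ≤ 1 / (32 * (2097152 * ((d : ℝ) + 1) ^ 2)) ∧ cK d L ≤ 1 / ((2 * (d : ℝ) + 1) * C3Gen d L) := by
  unfold cK
  refine ⟨min_le_left _ _, ?_, ?_, ?_, ?_, ?_, ?_, ?_, ?_, ?_, ?_⟩ <;>
    simp only [min_le_iff, le_refl, true_or, or_true]

/-- **the `α₀`-side of the regime**: `0 < α₀ ≤ cK d L` gives Prop. 2's hypotheses (`C₀α₀ ≤ ⅓`, `8α₀ ≤ c₂′`, hence `4α₀`, `2α₀ ≤ c₂′`), the
(131) exponent `4cα₀ ≤ ¼`, Prop. 7's `4480(d+1)²(d+4)α₀ ≤ ⅛`, Prop. 5's `2d·thetaGen ≤ L³/16`, and `α₀ ≤ 1`. [cite: Balaban1985Averaging, Proposition 4 p.39, (155) p.41] -/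
theorem alpha_regime (hL : 1 ≤ L) {α₀ : ℝ} (hα : 0 < α₀) (hαc : α₀ ≤ cK d L) :
    C0 d * α₀ ≤ 1 / 3 ∧ 8 * α₀ ≤ c2' d L ∧ 4 * α₀ ≤ c2' d L ∧ 2 * α₀ ≤ c2' d L ∧
    4 * (800 * ((d : ℝ) + 1) ^ 2 * ((d : ℝ) + 4)) * α₀ ≤ 1 / 4 ∧
    4480 * ((d : ℝ) + 1) ^ 2 * ((d : ℝ) + 4) * α₀ ≤ 1 / 8 ∧
    2 * (d : ℝ) * thetaGen d L α₀ ≤ (L : ℝ) ^ 3 / 16 ∧ α₀ ≤ 1 := by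
  obtain ⟨h0, h1, h2, h3, h4, h5, -, -, -, -, -⟩ := cK_le d L
  have hL0 : (0 : ℝ) < L := by exact_mod_cast hL
  have hC := C0_pos d
  have hd : (0 : ℝ) ≤ d := Nat.cast_nonneg d
  refine ⟨?_, by linarith, by linarith, by linarith, ?_, ?_, ?_, by linarith⟩
  · have h := hαc.trans h1
    rw [le_div_iff₀ (by positivity)] at h
    linarith
  · have hc : (0 : ℝ) < 16 * (800 * ((d : ℝ) + 1) ^ 2 * ((d : ℝ) + 4)) := by positivity
    have h := hαc.trans h3
    rw [le_div_iff₀ hc] at h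
    linarith
  · have hc : (0 : ℝ) < 8 * (4480 * ((d : ℝ) + 1) ^ 2 * ((d : ℝ) + 4)) := by positivity
    have h := hαc.trans h4
    rw [le_div_iff₀ hc] at h
    linarith
  · have hK : (0 : ℝ) < 3200 * ((d : ℝ) + 1) * ((d : ℝ) + 4) * (L : ℝ) ^ (d + 1) := by positivity
    have hc : (0 : ℝ) < 16 * (2 * (d : ℝ) + 1) * (3200 * ((d : ℝ) + 1) * ((d : ℝ) + 4) * (L : ℝ) ^ (d + 1)) := by positivity
    have h := hαc.trans h5
    rw [le_div_iff₀ hc] at h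
    unfold thetaGen
    -- `2d·Kα₀ ≤ (2d+1)·Kα₀ ≤ L³/16`
    have hmono : 2 * (d : ℝ) * (3200 * ((d : ℝ) + 1) * ((d : ℝ) + 4) * (L : ℝ) ^ (d + 1) * α₀)
        ≤ (2 * (d : ℝ) + 1) * (3200 * ((d : ℝ) + 1) * ((d : ℝ) + 4) * (L : ℝ) ^ (d + 1) * α₀) := by
      have : 0 ≤ 3200 * ((d : ℝ) + 1) * ((d : ℝ) + 4) * (L : ℝ) ^ (d + 1) * α₀ := by positivity
      nlinarith
    refine hmono.trans ?_
    rw [le_div_iff₀ (by norm_num : (0 : ℝ) < 16)]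
    linarith

/-- **the field side of the regime**: `0 ≤ t ≤ cK d L` gives the (123)-route field conditions (`8C₁t ≤ ¼`, `2t ≤ c₃/4`, `2t ≤ c₃`, `4t < c₃`),
Prop. 7's (`409600(d+1)²t ≤ 1`, `240000(d+1)³t ≤ ⅛`, `8C₁′t ≤ ¼`) and Prop. 5's `2d·C3Gen·t ≤ 1`. [cite: Balaban1985Averaging, Proposition 4 p.39, (155) p.41] -/
theorem field_regime (hL : 1 ≤ L) {t : ℝ} (htc : t ≤ cK d L) :
    8 * (131072 * ((d : ℝ) + 1) ^ 2) * t ≤ 1 / 4 ∧ 2 * t ≤ c3 d L / 4 ∧ 2 * t ≤ c3 d L ∧ 4 * t < c3 d L ∧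
    409600 * ((d : ℝ) + 1) ^ 2 * t ≤ 1 ∧ 240000 * ((d : ℝ) + 1) ^ 3 * t ≤ 1 / 8 ∧
    8 * (2097152 * ((d : ℝ) + 1) ^ 2) * t ≤ 1 / 4 ∧ 2 * (d : ℝ) * C3Gen d L * t ≤ 1 := by
  obtain ⟨-, -, -, -, -, -, h6, h7, h8, h9, h10⟩ := cK_le d L
  have hL0 : (0 : ℝ) < L := by exact_mod_cast hL
  have hc3 := c3_pos d hL
  have hC3 := C3Gen_pos' d hL
  have hd : (0 : ℝ) ≤ d := Nat.cast_nonneg d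
  have hd1 : (0 : ℝ) < ((d : ℝ) + 1) ^ 2 := by positivity
  refine ⟨?_, by linarith, by linarith, by linarith, ?_, ?_, ?_, ?_⟩
  · have h := htc.trans h9
    rw [le_div_iff₀ (by positivity)] at h
    nlinarith
  · have h := htc.trans h7
    rw [le_div_iff₀ (by positivity)] at h
    linarith
  · have h := htc.trans h8
    rw [le_div_iff₀ (by positivity)] at h
    linarith
  · have h := htc.trans h9
    rw [le_div_iff₀ (by positivity)] at h
    linarith
  · have h := htc.trans h10
    rw [le_div_iff₀ (by positivity)] at h
    nlinarith

/-- the two exponential smallness factors of the kernels, from the regime: `e^{4cα₀}(1 + 8C₁t) ≤ 2` ((123)-route, Props 4/6) and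
`e^{4480(d+1)²(d+4)α₀ + 240000(d+1)³t′}(1 + 8C₁′t) ≤ 2` (Prop. 7). [cite: Balaban1985Averaging, (131) p.38, Proposition 7 p.43] -/
theorem exp_regime (hL : 1 ≤ L) {α₀ t t' : ℝ} (hα : 0 < α₀) (hαc : α₀ ≤ cK d L) (ht : 0 ≤ t) (htc : t ≤ cK d L)
    (ht' : 0 ≤ t') (ht'c : t' ≤ cK d L) :
    Real.exp (4 * (800 * ((d : ℝ) + 1) ^ 2 * ((d : ℝ) + 4)) * α₀) * (1 + 8 * (131072 * ((d : ℝ) + 1) ^ 2) * t) ≤ 2 ∧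
    Real.exp (4 * (800 * ((d : ℝ) + 1) ^ 2 * ((d : ℝ) + 4)) * α₀) ≤ 2 ∧
    Real.exp (4480 * ((d : ℝ) + 1) ^ 2 * ((d : ℝ) + 4) * α₀ + 240000 * ((d : ℝ) + 1) ^ 3 * t')
        * (1 + 8 * (2097152 * ((d : ℝ) + 1) ^ 2) * t) ≤ 2 ∧
    Real.exp (4480 * ((d : ℝ) + 1) ^ 2 * ((d : ℝ) + 4) * α₀ + 240000 * ((d : ℝ) + 1) ^ 3 * t') ≤ 2 := by
  obtain ⟨-, -, -, -, hA1, hA2, -, -⟩ := alpha_regime (d := d) hL hα hαc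
  obtain ⟨hT1, -, -, -, -, -, hT2, -⟩ := field_regime (d := d) hL htc
  obtain ⟨-, -, -, -, -, hT3, -, -⟩ := field_regime (d := d) hL ht'c
  have hx0 : 0 ≤ 4 * (800 * ((d : ℝ) + 1) ^ 2 * ((d : ℝ) + 4)) * α₀ := by positivity
  have hy0 : 0 ≤ 8 * (131072 * ((d : ℝ) + 1) ^ 2) * t := by positivity
  have hx0' : 0 ≤ 4480 * ((d : ℝ) + 1) ^ 2 * ((d : ℝ) + 4) * α₀ + 240000 * ((d : ℝ) + 1) ^ 3 * t' := by positivity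
  have hy0' : 0 ≤ 8 * (2097152 * ((d : ℝ) + 1) ^ 2) * t := by positivity
  exact ⟨exp_mul_le_two hx0 hA1 hy0 hT1, exp_le_two hx0 hA1, exp_mul_le_two hx0' (by linarith) hy0' hT2,
    exp_le_two hx0' (by linarith)⟩

end Thresholds

/-! ## §2 Bounded fields: sup norm and the scaling `B = η•A` -/

section Fields

variable {𝔸 : Type} [NormedRing 𝔸] [NormOneClass 𝔸] [NormedAlgebra ℂ 𝔸] [CompleteSpace 𝔸]

/-- «|A| = sup_b|A_b|» for a bounded field. [cite: Balaban1985Averaging, (109) p.34, (19) p.21] -/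
def supNorm (A : BddFld d 𝔸) : ℝ := ⨆ b : Site d × Fin d, ‖A.1 b.1 b.2‖

omit [NormOneClass 𝔸] [NormedAlgebra ℂ 𝔸] [CompleteSpace 𝔸] in
/-- `‖A_b‖ ≤ |A|` and `0 ≤ |A|`. [cite: Balaban1985Averaging, (109) p.34] -/
theorem supNorm_spec (A : BddFld d 𝔸) : (∀ (x : Site d) (κ : Fin d), ‖A.1 x κ‖ ≤ supNorm A) ∧ 0 ≤ supNorm A :=
  ⟨fun x κ => norm_le_fldNorm A x κ, fldNorm_nonneg A⟩

omit [NormOneClass 𝔸] [CompleteSpace 𝔸] in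
/-- **the scaling `B = ηA`** («`U₁ = e^{iηA}`», p. 37): `sup‖ηA‖ ≤ η|A|` and `Lᵏ·(η|A|) = |A|`. [cite: Balaban1985Averaging, p.37 (before (127)), (52) p.26] -/
theorem scaling_data (L k : ℕ) (hL : 1 ≤ L) (A : Site d → Fin d → 𝔸) {a : ℝ} (hA : ∀ (x : Site d) (κ : Fin d), ‖A x κ‖ ≤ a) :
    (∀ (x : Site d) (κ : Fin d), ‖(((L : ℝ) ^ k)⁻¹ • A) x κ‖ ≤ ((L : ℝ) ^ k)⁻¹ * a) ∧ (L : ℝ) ^ k * (((L : ℝ) ^ k)⁻¹ * a) = a := by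
  have hL0 : (0 : ℝ) < L := by exact_mod_cast hL
  have hη0 : 0 ≤ ((L : ℝ) ^ k)⁻¹ := by positivity
  refine ⟨fun x κ => ?_, ?_⟩
  · rw [Pi.smul_apply, Pi.smul_apply, norm_smul, Real.norm_of_nonneg hη0]
    exact mul_le_mul_of_nonneg_left (hA x κ) hη0
  · rw [← mul_assoc, mul_inv_cancel₀ (by positivity), one_mul]

omit [NormOneClass 𝔸] [CompleteSpace 𝔸] in
/-- the inserted scaled field of a finite family of bond variables is bounded by `η‖a‖` and bondwise analytic in `a`. [cite: Balaban1985Averaging, Proposition 4 p.38] -/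
theorem ins_data (L k : ℕ) (hL : 1 ≤ L) (S : Finset (Site d × Fin d)) (a : S → 𝔸) :
    (∀ (x : Site d) (κ : Fin d), ‖(((L : ℝ) ^ k)⁻¹ • insCfg S a) x κ‖ ≤ ((L : ℝ) ^ k)⁻¹ * ‖a‖) ∧
      ∀ (x : Site d) (κ : Fin d), AnalyticAt ℂ (fun t : S → 𝔸 => (((L : ℝ) ^ k)⁻¹ • insCfg S t) x κ) a := by
  refine ⟨(scaling_data L k hL (insCfg S a) (fun x κ => norm_insCfg_le S a x κ)).1, fun x κ => ?_⟩
  show AnalyticAt ℂ (fun t : S → 𝔸 => ((L : ℝ) ^ k)⁻¹ • insCfg S t x κ) a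
  exact (analyticAt_insCfg S x κ a).fun_const_smul

end Fields

/-! ## §3 The carrier family -/

section Carrier

variable (𝔸 : Type) [NormedRing 𝔸] [NormOneClass 𝔸] [NormedAlgebra ℂ 𝔸] [CompleteSpace 𝔸] (G : Subgroup 𝔸ˣ)

/-- **The concrete `k`-fold family of B7 Sect. D on `ℤᵈ`** (every field explained in the module docstring): `Cfg` = all configurations (with the
guard `grpDefect G` inside `plaqDevEta`), `Fld` = bounded fields in the printed variable `A` (`U₁ = e^{ηA}`), `plaqDevEta U = η⁻²·pdev U + grpDefect
G U`, `fldNorm = |A|`, `IsAnalyticQk`/`remCk`/`dQk`/`dCk` = the composite (127) `Q_k(U₀, ηA)(c)` and its remainder/derivatives at the bond `c` in the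
direction of the bond `b`, `pert U₀ A′ = e^{ηA′}U₀`, `avgRatioDev` = left side of (164), `IsJointlyAnalytic` = joint analyticity of
`(A′, A) ↦ Q_k(e^{ηA′}U₀, ηA)(c)` on product polydiscs. [cite: Balaban1985Averaging, (52) p.26, (127) p.37, (134) p.38, (137)–(138) p.39, (156)–(158) p.42, (164) p.43, Proposition 7 p.43] -/
def concreteKExp (L : ℕ) (i : KIdx d) : B7.KExp where
  Cfg := Site d → Fin d → 𝔸ˣ
  Fld := BddFld d 𝔸
  k := i.k
  plaqDevEta U := pdev U * ((L : ℝ) ^ i.k) ^ 2 + grpDefect G U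
  fldNorm A := supNorm A
  IsAnalyticQk U₀ r := ∀ S : Finset (Site d × Fin d),
    AnalyticOnNhd ℂ (fun a : S → 𝔸 => logCovIter L U₀ (((L : ℝ) ^ i.k)⁻¹ • insCfg S a) i.k i.z i.κ) {a | ∀ s, ‖a s‖ < r}
  remCk U₀ A := ‖logCovIter L U₀ (((L : ℝ) ^ i.k)⁻¹ • A.1) i.k i.z i.κ - linCovIter L U₀ (((L : ℝ) ^ i.k)⁻¹ • A.1) i.k i.z i.κ‖
  dQk U₀ A := ⨆ X : Metric.closedBall (0 : 𝔸) 1,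
    ((((L : ℝ) ^ i.k)⁻¹) ^ d)⁻¹ * ‖lineDeriv ℂ (fun A' => logCovIter L U₀ (((L : ℝ) ^ i.k)⁻¹ • A') i.k i.z i.κ) A.1 (bump i.y i.μ X.1)‖
  dCk U₀ A := ⨆ X : Metric.closedBall (0 : 𝔸) 1,
    ((((L : ℝ) ^ i.k)⁻¹) ^ d)⁻¹ * ‖lineDeriv ℂ (fun A' => CCovIter L U₀ (((L : ℝ) ^ i.k)⁻¹ • A') i.k i.z i.κ) A.1 (bump i.y i.μ X.1)‖
  pert U₀ A' := expCfg (((L : ℝ) ^ i.k)⁻¹ • A'.1) * U₀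
  avgRatioDev U₀ A' := ⨆ c : Site d × Fin d,
    ‖((avgIter L (expCfg (((L : ℝ) ^ i.k)⁻¹ • A'.1) * U₀) i.k c.1 c.2 : 𝔸ˣ) : 𝔸) *
        (((avgIter L U₀ i.k c.1 c.2)⁻¹ : 𝔸ˣ) : 𝔸) - 1‖
  IsJointlyAnalytic U₀ r' r := ∀ S' S : Finset (Site d × Fin d),
    AnalyticOnNhd ℂ (fun p : (S' → 𝔸) × (S → 𝔸) =>
        logCovIter L (expCfg (((L : ℝ) ^ i.k)⁻¹ • insCfg S' p.1) * U₀) (((L : ℝ) ^ i.k)⁻¹ • insCfg S p.2) i.k i.z i.κ)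
      {p | (∀ s, ‖p.1 s‖ < r') ∧ ∀ s, ‖p.2 s‖ < r}

end Carrier

/-! ## §4 The four propositions for the family -/

section Props

variable {𝔸 : Type} [NormedRing 𝔸] [NormOneClass 𝔸] [NormedAlgebra ℂ 𝔸] [CompleteSpace 𝔸] {G : Subgroup 𝔸ˣ}

/-- **Proposition 4 (134)–(135) + its analyticity clause AS TYPED (`B7.Prop4Printed`) for `concreteKExp 𝔸 G L`** (`L ≥ 2`, `G` `AvgClosed`):
witnesses `C₂ = 16C₁`, `C₁ = 131072(d+1)²` («`C₂` depends on `d`», k-uniform), `c₄ = cK d L` («depends on `d` and `L`»).  For `U₀` with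
`plaqDevEta U₀ < α₀ ≤ c₄` (`G`-valued with (52), `regime_of_dev_lt`): the analyticity of `A ↦ Q_k(U₀, ηA)(c)` on the polydisc of radius `α₁`
is `B7Prop6GeneralAnalytic.prop4_general_analyticAt` along `a ↦ η·insCfg S a`; (135) `‖C_k(U₀, A)(c)‖ ≤ 8C₁e^{4cα₀}|A|² ≤ 16C₁|A|²` is
`B7Eq123General.prop4_general` at `j = k` (`Lᵏ·η|A| = |A|`, `e^{4cα₀} ≤ 2`). [cite: Balaban1985Averaging, Proposition 4 (134)–(135) pp.38–39, (127) p.37] -/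
theorem prop4Printed_K (L : ℕ) (hL : 2 ≤ L) (hG : AvgClosed d L G) :
    B7.Prop4Printed (concreteKExp 𝔸 G (d := d) L) := by
  have hL1 : 1 ≤ L := le_trans (by norm_num) hL
  refine ⟨16 * (131072 * ((d : ℝ) + 1) ^ 2), cK d L, by positivity, cK_pos d hL1, ?_⟩
  rintro ⟨k, z, κ, y, μ⟩ α₀ α₁ hα₀ hα₀c hα₁ hα₁c U₀ hdev
  dsimp only [concreteKExp] at U₀ hdev ⊢
  obtain ⟨hC0, -, hα4, -, -, -, -, hα1⟩ := alpha_regime (d := d) hL1 hα₀ hα₀c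
  obtain ⟨hU₀, h52⟩ := regime_of_dev_lt hL1 hdev hα1
  refine ⟨fun S => ?_, fun A hA => ?_⟩
  · -- analyticity on the polydisc of radius `α₁`
    intro a ha
    have hna : ‖a‖ < α₁ := (pi_norm_lt_iff hα₁).2 ha
    obtain ⟨hB, hBa⟩ := ins_data L k hL1 S a
    have hsc := (scaling_data L k hL1 (insCfg S a) (fun x κ' => norm_insCfg_le S a x κ')).2
    obtain ⟨hs, -, -, -⟩ := exp_regime (d := d) hL1 hα₀ hα₀c (norm_nonneg a) (hna.le.trans hα₁c) (norm_nonneg a)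
      (hna.le.trans hα₁c)
    obtain ⟨-, -, hc3, -⟩ := field_regime (d := d) hL1 (hna.le.trans hα₁c)
    rw [← hsc] at hs hc3
    exact B7Prop6GeneralAnalytic.prop4_general_analyticAt L hL hG k U₀ hU₀ hα₀ hC0 hα4 h52
      (fun t : S → 𝔸 => ((L : ℝ) ^ k)⁻¹ • insCfg S t) hBa (by positivity) hB hs hc3 k le_rfl z κ
  · -- (135)
    obtain ⟨hAa, ha0⟩ := supNorm_spec A
    set a := supNorm A with ha
    obtain ⟨hB, hsc⟩ := scaling_data L k hL1 A.1 hAa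
    obtain ⟨hs, hexp, -, -⟩ := exp_regime (d := d) hL1 hα₀ hα₀c ha0 (hA.le.trans hα₁c) ha0 (hA.le.trans hα₁c)
    obtain ⟨-, -, hc3, -⟩ := field_regime (d := d) hL1 (hA.le.trans hα₁c)
    rw [← hsc] at hs hc3
    have h := (B7Eq123General.prop4_general L hL hG k U₀ hU₀ hα₀ hC0 hα4 h52 (((L : ℝ) ^ k)⁻¹ • A.1) (by positivity) hB hs hc3
      k le_rfl).1 z κ
    rw [hsc] at h
    refine h.trans ?_
    have hC : 0 ≤ 8 * (131072 * ((d : ℝ) + 1) ^ 2) * a ^ 2 := by positivity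
    nlinarith [mul_le_mul_of_nonneg_left hexp hC]

/-- **Proposition 5 (156)–(157) AS TYPED (`B7.Prop5Printed`) for `concreteKExp 𝔸 G L`** (`L ≥ 2`, `G` `AvgClosed`): witnesses
`C′₁ = 1600(d+1)(d+4)L^{d+1}` (so `2C′₁α₀ = thetaGen d L α₀`), `C₃ = C3Gen d L`, `c₅ = cK d L`.  For `plaqDevEta U₀ < α₀` and `|A| < α₁`: in every
single-bond direction `X·δ_b`, `‖X‖ ≤ 1`, the densities `η^{−d}‖dQ_k(U₀, ηA; Xδ_b)(c)‖ ≤ 1 + 2C′₁α₀ + C₃|A|` and `η^{−d}‖dC_k(U₀, A; Xδ_b)(c)‖ ≤ C₃|A|`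
are `B7Prop5General.prop5_general_156_printed` / `prop5_general_157_printed`, the smallness (145)/(155) being `smallness_sufficient` fed from the
regime. [cite: Balaban1985Averaging, Proposition 5 (156)–(157) p.42, (137)–(138) p.39, (155) p.41] -/
theorem prop5Printed_K (L : ℕ) (hL : 2 ≤ L) (hG : AvgClosed d L G) :
    B7.Prop5Printed (concreteKExp 𝔸 G (d := d) L) := by
  have hL1 : 1 ≤ L := le_trans (by norm_num) hL
  have hL0 : (0 : ℝ) < L := by exact_mod_cast hL1
  refine ⟨1600 * ((d : ℝ) + 1) * ((d : ℝ) + 4) * (L : ℝ) ^ (d + 1), C3Gen d L, cK d L, by positivity, C3Gen_pos' d hL1,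
    cK_pos d hL1, ?_⟩
  rintro ⟨k, z, κ, y, μ⟩ α₀ α₁ hα₀ hα₀c hα₁ hα₁c U₀ hdev A hA
  dsimp only [concreteKExp] at U₀ hdev A hA ⊢
  obtain ⟨hC0, -, hα4, -, -, -, hθ, hα1⟩ := alpha_regime (d := d) hL1 hα₀ hα₀c
  obtain ⟨hU₀, h52⟩ := regime_of_dev_lt hL1 hdev hα1
  obtain ⟨hAa, ha0⟩ := supNorm_spec A
  set a := supNorm A with ha
  have hac : a ≤ cK d L := hA.le.trans hα₁c
  obtain ⟨hs, -, -, -⟩ := exp_regime (d := d) hL1 hα₀ hα₀c ha0 hac ha0 hac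
  obtain ⟨-, -, -, hc3, -, -, -, hC3a⟩ := field_regime (d := d) hL1 hac
  -- (145)/(155) from the regime (`smallness_sufficient` at `k = 0`, `L⁰·a = a`)
  have hC3a' : 2 * (d : ℝ) * C3Gen d L * ((L : ℝ) ^ 0 * a) ≤ 1 := by rwa [pow_zero, one_mul]
  obtain ⟨h145, h155⟩ := B7Prop5General.smallness_sufficient hL d 0 hα₀.le hθ hC3a'
  rw [pow_zero, one_mul] at h155
  have hθeq : 2 * (1600 * ((d : ℝ) + 1) * ((d : ℝ) + 4) * (L : ℝ) ^ (d + 1)) * α₀ = thetaGen d L α₀ := by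
    unfold thetaGen; ring
  have hηd : 0 < ((L : ℝ) ^ k)⁻¹ ^ d := by positivity
  have hC3 := C3Gen_pos' d hL1
  have hθ0 : 0 ≤ thetaGen d L α₀ := by unfold thetaGen; positivity
  have hM : 0 ≤ 1 + thetaGen d L α₀ + C3Gen d L * a := by positivity
  have hM' : 0 ≤ C3Gen d L * a := by positivity
  refine ⟨?_, ?_⟩
  · -- (156)
    rw [hθeq]
    refine Real.iSup_le (fun X => ?_) hM
    have hX : ‖X.1‖ ≤ 1 := mem_closedBall_zero_iff.1 X.2
    obtain ⟨-, hb⟩ := B7Prop5General.prop5_general_156_printed L hL hG k U₀ hU₀ hα₀ hC0 hα4 h52 h145 A.1 ha0 hAa hs hc3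
      h155 y μ X.1 z κ
    calc (((L : ℝ) ^ k)⁻¹ ^ d)⁻¹ * ‖lineDeriv ℂ (fun A' => logCovIter L U₀ (((L : ℝ) ^ k)⁻¹ • A') k z κ) A.1 (bump y μ X.1)‖
        ≤ (((L : ℝ) ^ k)⁻¹ ^ d)⁻¹ * ((1 + thetaGen d L α₀ + C3Gen d L * a) * (((L : ℝ) ^ k)⁻¹ ^ d * ‖X.1‖)) :=
          mul_le_mul_of_nonneg_left hb (by positivity)
      _ = (1 + thetaGen d L α₀ + C3Gen d L * a) * ‖X.1‖ := inv_mul_mul_cancel hηd.ne'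
      _ ≤ (1 + thetaGen d L α₀ + C3Gen d L * a) * 1 := mul_le_mul_of_nonneg_left hX hM
      _ = 1 + thetaGen d L α₀ + C3Gen d L * a := mul_one _
  · -- (157)
    refine Real.iSup_le (fun X => ?_) hM'
    have hX : ‖X.1‖ ≤ 1 := mem_closedBall_zero_iff.1 X.2
    obtain ⟨hd, hb, -⟩ := B7Prop5General.prop5_general_157_printed L hL hG k U₀ hU₀ hα₀ hC0 hα4 h52 h145 A.1 ha0 hAa hs hc3
      h155 y μ X.1 z κ
    rw [hd.lineDeriv]
    calc (((L : ℝ) ^ k)⁻¹ ^ d)⁻¹ * ‖dCov L U₀ (((L : ℝ) ^ k)⁻¹ • A.1) (bump y μ (((L : ℝ) ^ k)⁻¹ • X.1)) k z κ‖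
        ≤ (((L : ℝ) ^ k)⁻¹ ^ d)⁻¹ * (C3Gen d L * a * (((L : ℝ) ^ k)⁻¹ ^ d * ‖X.1‖)) := mul_le_mul_of_nonneg_left hb (by positivity)
      _ = C3Gen d L * a * ‖X.1‖ := inv_mul_mul_cancel hηd.ne'
      _ ≤ C3Gen d L * a * 1 := mul_le_mul_of_nonneg_left hX hM'
      _ = C3Gen d L * a := mul_one _

/-- **Proposition 6 (164) AS TYPED (`B7.Prop6Printed`) for `concreteKExp 𝔸 G L`** (`L ≥ 2`, `G` `AvgClosed`): witnesses `O(1) = 200(d+1)`,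
`c = cK d L`.  For `plaqDevEta U₀ < α₀` and `|A′| < α₁`: at every bond `c` of `Ω^{(k)}`, `‖\overline{U′U₀}ᵏ(c)(Ū₀ᵏ(c))⁻¹ − 1‖ ≤ 200(d+1)|A′|`
(`B7Prop6GeneralLevels.eq164_general_unconditional`, `Lᵏ·η|A′| = |A′|`), hence the supremum is `≤ 200(d+1)|A′| < 200(d+1)α₁`.
[cite: Balaban1985Averaging, Proposition 6 (164) p.43] -/
theorem prop6Printed_K (L : ℕ) (hL : 2 ≤ L) (hG : AvgClosed d L G) :
    B7.Prop6Printed (concreteKExp 𝔸 G (d := d) L) := by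
  have hL1 : 1 ≤ L := le_trans (by norm_num) hL
  refine ⟨200 * ((d : ℝ) + 1), cK d L, by positivity, cK_pos d hL1, ?_⟩
  rintro ⟨k, z, κ, y, μ⟩ α₀ α₁ hα₀ hα₀c hα₁ hα₁c U₀ hdev A' hA'
  dsimp only [concreteKExp] at U₀ hdev A' hA' ⊢
  obtain ⟨hC0, -, hα4, -, -, -, -, hα1⟩ := alpha_regime (d := d) hL1 hα₀ hα₀c
  obtain ⟨hU₀, h52⟩ := regime_of_dev_lt hL1 hdev hα1
  obtain ⟨hAa, ha0⟩ := supNorm_spec A'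
  set a := supNorm A' with ha
  have hac : a ≤ cK d L := hA'.le.trans hα₁c
  obtain ⟨hB, hsc⟩ := scaling_data L k hL1 A'.1 hAa
  obtain ⟨hs, -, -, -⟩ := exp_regime (d := d) hL1 hα₀ hα₀c ha0 hac ha0 hac
  obtain ⟨-, -, hc3, -⟩ := field_regime (d := d) hL1 hac
  rw [← hsc] at hs hc3
  have hpt : ∀ c : Site d × Fin d,
      ‖((avgIter L (expCfg (((L : ℝ) ^ k)⁻¹ • A'.1) * U₀) k c.1 c.2 : 𝔸ˣ) : 𝔸) * (((avgIter L U₀ k c.1 c.2)⁻¹ : 𝔸ˣ) : 𝔸) - 1‖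
        ≤ 200 * ((d : ℝ) + 1) * a := by
    intro c
    have h := B7Prop6GeneralLevels.eq164_general_unconditional L hL hG k U₀ hU₀ hα₀ hC0 hα4 h52 (((L : ℝ) ^ k)⁻¹ • A'.1)
      (by positivity) hB hs hc3 c.1 c.2
    rwa [hsc] at h
  refine lt_of_le_of_lt (Real.iSup_le hpt (by positivity)) ?_
  have hd : (0 : ℝ) < 200 * ((d : ℝ) + 1) := by positivity
  exact mul_lt_mul_of_pos_left hA' hd

/-- **Proposition 7 AS TYPED (`B7.Prop7Printed`) for `concreteKExp 𝔸 G L`** (`L ≥ 2`, `G` `AvgClosed`): witnesses `C₂ = 16C₁′`, `C₁′ =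
2097152(d+1)²` (independent of `U′`, `k`), `c = cK d L`.  For `plaqDevEta U₀ < α₀ ≤ c`: (i) «analytic in complex variables `A′, A`» on the
polydisc `{‖A′_b‖ < α₁} × {‖A_b‖ < α₁}` in every pair of finite sets of bond variables — `B7Prop7Levels.prop7_analyticAt` with the parameter
space `𝔸^{S′} × 𝔸^{S}` and the analytic coordinates `η·insCfg`; (ii) «Proposition 4 holds uniformly in `A′`»: for `|A′|, |A| < α₁`,
`‖C_k(U′U₀, A)(c)‖ ≤ 8C₁′e^{E}|A|² ≤ 16C₁′|A|²` at `U′U₀ = e^{ηA′}U₀` — `B7Prop7Levels.prop7_prop4_uniform` at `j = k` with `e^{E} ≤ 2` on the regime.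
[cite: Balaban1985Averaging, Proposition 7 p.43, Proposition 4 (134)–(135) pp.38–39, (158) p.42] -/
theorem prop7Printed_K (L : ℕ) (hL : 2 ≤ L) (hG : AvgClosed d L G) :
    B7.Prop7Printed (concreteKExp 𝔸 G (d := d) L) := by
  have hL1 : 1 ≤ L := le_trans (by norm_num) hL
  refine ⟨16 * (2097152 * ((d : ℝ) + 1) ^ 2), cK d L, by positivity, cK_pos d hL1, ?_⟩
  rintro ⟨k, z, κ, y, μ⟩ α₀ α₁ hα₀ hα₀c hα₁ hα₁c U₀ hdev
  dsimp only [concreteKExp] at U₀ hdev ⊢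
  obtain ⟨hC0, hα8, -, -, -, -, -, hα1⟩ := alpha_regime (d := d) hL1 hα₀ hα₀c
  obtain ⟨hU₀, h52⟩ := regime_of_dev_lt hL1 hdev hα1
  refine ⟨fun S' S => ?_, fun A' A hA' hA => ?_⟩
  · -- (i) joint analyticity on the product polydisc
    intro p hp
    have hn' : ‖p.1‖ < α₁ := (pi_norm_lt_iff hα₁).2 hp.1
    have hn : ‖p.2‖ < α₁ := (pi_norm_lt_iff hα₁).2 hp.2
    have hc' : ‖p.1‖ ≤ cK d L := hn'.le.trans hα₁c
    have hc : ‖p.2‖ ≤ cK d L := hn.le.trans hα₁c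
    obtain ⟨hB'p, -⟩ := ins_data L k hL1 S' p.1
    obtain ⟨hBp, -⟩ := ins_data L k hL1 S p.2
    have hsc' := (scaling_data L k hL1 (insCfg S' p.1) (fun x κ' => norm_insCfg_le S' p.1 x κ')).2
    have hsc := (scaling_data L k hL1 (insCfg S p.2) (fun x κ' => norm_insCfg_le S p.2 x κ')).2
    obtain ⟨hs', -, -, -⟩ := exp_regime (d := d) hL1 hα₀ hα₀c (norm_nonneg p.1) hc' (norm_nonneg p.1) hc'
    obtain ⟨-, -, hs, -⟩ := exp_regime (d := d) hL1 hα₀ hα₀c (norm_nonneg p.2) hc (norm_nonneg p.1) hc'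
    obtain ⟨-, -, hc3', -, hb1', -, -, -⟩ := field_regime (d := d) hL1 hc'
    obtain ⟨-, hc3, -, -, -, -, -, -⟩ := field_regime (d := d) hL1 hc
    rw [← hsc'] at hs' hc3' hb1' hs
    rw [← hsc] at hs hc3
    -- the coordinates `p ↦ η·insCfg S′ p.1`, `p ↦ η·insCfg S p.2` are analytic
    have hB'a : ∀ (x : Site d) (κ' : Fin d),
        AnalyticAt ℂ (fun t : (S' → 𝔸) × (S → 𝔸) => (((L : ℝ) ^ k)⁻¹ • insCfg S' t.1) x κ') p := fun x κ' => by
      show AnalyticAt ℂ (fun t : (S' → 𝔸) × (S → 𝔸) => ((L : ℝ) ^ k)⁻¹ • insCfg S' t.1 x κ') p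
      exact ((analyticAt_insCfg S' x κ' p.1).comp analyticAt_fst).fun_const_smul
    have hBa : ∀ (x : Site d) (κ' : Fin d),
        AnalyticAt ℂ (fun t : (S' → 𝔸) × (S → 𝔸) => (((L : ℝ) ^ k)⁻¹ • insCfg S t.2) x κ') p := fun x κ' => by
      show AnalyticAt ℂ (fun t : (S' → 𝔸) × (S → 𝔸) => ((L : ℝ) ^ k)⁻¹ • insCfg S t.2 x κ') p
      exact ((analyticAt_insCfg S x κ' p.2).comp analyticAt_snd).fun_const_smul
    exact B7Prop7Levels.prop7_analyticAt L hL hG k U₀ hU₀ hα₀ hC0 hα8 h52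
      (fun t : (S' → 𝔸) × (S → 𝔸) => ((L : ℝ) ^ k)⁻¹ • insCfg S' t.1) hB'a (by positivity) hB'p hs' hc3' hb1'
      (fun t : (S' → 𝔸) × (S → 𝔸) => ((L : ℝ) ^ k)⁻¹ • insCfg S t.2) hBa (by positivity) hBp hs hc3 k le_rfl z κ
  · -- (ii) (135) at the background `e^{ηA′}U₀`, uniformly in `A′`
    obtain ⟨hAa', ha0'⟩ := supNorm_spec A'
    obtain ⟨hAa, ha0⟩ := supNorm_spec A
    set a' := supNorm A' with ha'
    set a := supNorm A with ha
    have hac' : a' ≤ cK d L := hA'.le.trans hα₁c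
    have hac : a ≤ cK d L := hA.le.trans hα₁c
    obtain ⟨hB', hsc'⟩ := scaling_data L k hL1 A'.1 hAa'
    obtain ⟨hB, hsc⟩ := scaling_data L k hL1 A.1 hAa
    obtain ⟨hs', -, -, -⟩ := exp_regime (d := d) hL1 hα₀ hα₀c ha0' hac' ha0' hac'
    obtain ⟨-, -, hs, hexp⟩ := exp_regime (d := d) hL1 hα₀ hα₀c ha0 hac ha0' hac'
    obtain ⟨-, -, hc3', -, hb1', -, -, -⟩ := field_regime (d := d) hL1 hac'
    obtain ⟨-, hc3, -, -, -, -, -, -⟩ := field_regime (d := d) hL1 hac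
    rw [← hsc'] at hs' hc3' hb1' hs hexp
    rw [← hsc] at hs hc3
    have h := (B7Prop7Levels.prop7_prop4_uniform L hL hG k U₀ hU₀ hα₀ hC0 hα8 h52 (((L : ℝ) ^ k)⁻¹ • A'.1) (by positivity) hB' hs'
      hc3' hb1' (((L : ℝ) ^ k)⁻¹ • A.1) (by positivity) hB hs hc3 k le_rfl).1 z κ
    rw [hsc] at h
    refine h.trans ?_
    have hC : 0 ≤ 8 * (2097152 * ((d : ℝ) + 1) ^ 2) * a ^ 2 := by positivity
    nlinarith [mul_le_mul_of_nonneg_left hexp hC]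

/-- **The four `k`-fold conjuncts of `B7.Concl` for ONE family**: `p4 ∧ p5 ∧ p6 ∧ p7` for `concreteKExp 𝔸 G L`, `L ≥ 2`, `G` `AvgClosed`.
[cite: Balaban1985Averaging, Proposition 4 pp.38–39, Proposition 5 p.42, Propositions 6–7 p.43] -/
theorem p4567_K (L : ℕ) (hL : 2 ≤ L) (hG : AvgClosed d L G) :
    B7.Prop4Printed (concreteKExp 𝔸 G (d := d) L) ∧ B7.Prop5Printed (concreteKExp 𝔸 G (d := d) L) ∧
      B7.Prop6Printed (concreteKExp 𝔸 G (d := d) L) ∧ B7.Prop7Printed (concreteKExp 𝔸 G (d := d) L) :=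
  ⟨prop4Printed_K L hL hG, prop5Printed_K L hL hG, prop6Printed_K L hL hG, prop7Printed_K L hL hG⟩

end Props

end Literature.MathematicalPhysics.QuantumFieldTheory.Balaban1983to89.B7ConclKExp

end
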